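import Summits.QuantumFields.YangMills.Theorems.BalabanUVNodesN14ClassLawRoadsBinderAtSpineReadingOfRecord13CoPHV
import Summits.QuantumFields.YangMills.Theorems.BalabanUVNodesN19ShapeFaceN14AtRecordTVSharp

/-!
# BalabanUVNodes ∕ N14 — THE SHARP-CONSTANT EDITION of N14's (I)-binder and of N19′'s core AT THE SPINE READINGS OF RECORD `crOfRecord₁₃At ∕ crOfRecord₁₃VAt K₀ jcut sh`
# (dag-n19-w2 g3's optimal TV-tilt constant `4·e^{2l₀}` ↦ `2·e^{2l₀}`, attained odds form `2·e^{2l₀}ρ ∕ (1 + (e^{2l₀} − 1)ρ)`, carried by ONE-NAME swaps onto this lineage)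

Cell `pub-ymgap` (HUMAN RULING D-0062 Track A; director-ym №197 ∕ HUMAN RULING D-0149 width push), WIDTH SEAT `pub-ymgap-dag-n14-w2` (g4, harness re-seat), payload «N14 DEPENDENT
on §N19 s1 ∕ U3 — take N19-side typed sub-lemmas by name».  The lane hand dag-n19-w2 g3 gave this lineage on the bus (LANDED-2, INBOX l.28406: «the record-level drop-ins
`…N19ShapeFaceN14AtRecordTVSharp.tiltedMeanMatching_of_tv_atKeys_half ∕ _sharp` have the SAME binder prefix as the g0 `tiltedMeanMatching_of_tv_atKeys` your §3∕§4 call — one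
name + import halves the `l₀·η_K` share of your NE7 radius; your v1.x»).  A SIBLING of p593287 `…N14BinderAtSpineReadingOfRecord13CoPH` (392 l.) ∕ p596111 `…CoPHV` (208 l.) ∕
p603135 `…ClassLawRoadsBinder…CoPHV` — the 400-line cap forbids appending in place; nothing of the parents is edited or re-declared.  Filed `--kind proof --supports
stmt-QuantumFields-20544 --as helper` (K3⁷ `SpineGivenEndpointR13SepCoPH`, skeleton v5 941dddb108cbaacf UNTOUCHED — these texts live below the skeleton key).  COUNT-NEUTRAL.
THEOREMS ONLY (0 `def`).  Imports g3 FILE 3 (⇒ the whole n14-w2 lineage g2∕g3) and dag-n19-w2 g3's `…N19ShapeFaceN14AtRecordTVSharp` (p602877) ONLY; every cited lemma BY NAME.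

WHAT IS PROVED (binder prefixes of the parents VERBATIM; `N`-, `K₀`-, `jcut`-, `sh`-generic).
* §1 (the ₁₃ reading `crOfRecord₁₃At`, dag-n20-d p587226): `tiltedMeanMatching_crOfRecord₁₃At_of_tv_half` — p593287 §3 with `η K = 2·e^{2l₀}·ρ K` (was `4·e^{2l₀}·ρ K`);
  `tiltedMeanMatching_crOfRecord₁₃At_of_tv_sharp` — the attained constant `η K = 2·e^{2l₀}ρ K ∕ (1 + (e^{2l₀} − 1)ρ K)`; ★ `core_reading₁₃_of_coreZero_of_tv_half` — p593287 §4's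
  edge with the RATE DISPLAYED instead of ∃-hidden: (V) the vacuum bracket `δ₀` + (SH) the shell split in MGF-part form + (I) U3's TV sentence on the SHELL-FREE class laws ⇒
  `NE7.Core 1 1 (classSet₁₃ …) (badClass₁₃ … jcut) (weightA₁₃ − sh.1) (weightB₁₃ − sh.2) (K ↦ δ₀ K + 2·e²·ρ K)` (dag-n19-d module 14 `core_of_coreZero_mgfForm` BY NAME; the g2 road
  gives `δ₀ K + 4·e²·ρ K` inside its ∃); no summability letter is needed for the displayed form.
* §2 (the V reading `crOfRecord₁₃VAt`, dag-n20-d p590105, volume letter `F.side ^ 4`): `tiltedMeanMatching_crOfRecord₁₃VAt_of_tv_half ∕ _sharp` (p596111 §1 twins);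
  ★ `core_readingV₁₃_of_coreZero_of_tv_half` (`K ↦ δ₀ K + (1 ∕ F.side⁴)·(2·e²·ρ K)`); `core_readingV₁₃_shellSplitOfRecord_of_coreZero_of_tv_half` — (SH) DISCHARGED at n21-d's
  shell split of record `shellSplitOfRecord₁₃At N K₀ ρA ρB` (the shell sibling p594686's `mgfForm_shellA₁₃ ∕ B₁₃`, `shellMeasA₁₃_le ∕ B₁₃_le` BY NAME).
* §3 (NE7-S_cl road, p603135's twins): `tiltedMeanMatching_crOfRecord₁₃VAt_of_classSandwich_half` — ONE-constant class-measure sandwich of width `r K` on the FULL class laws of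
  record ⇒ N14's binder with `η K = 2·e^{2l₀}·(e^{2 r K} − 1)` (was `4·…`; dag-n19-c `tvSandwich_of_classSandwich` then §2); `…_of_classSandwich_sharp` (odds form);
  `tiltedMeanMatching_crOfRecord₁₃VAt_cutZero_of_classSandwich_half` (zero cut, from the t-free all-keys sentence).
The parents' ∃-statements (`exists_tiltedMeanMatching_summable_…`, `coreEdge_reading₁₃_…`, `core_crOfRecord₁₃(V)At_…` at the canonical `δ`) are NOT re-typed: a sharper constant
does not change an ∃-sentence; what changes is what is DISPLAYED (explicit `η`, explicit `δ`).

HONEST FRAMING.  Count-neutral by-name knit.  ZERO ESTIMATE CONTENT: `hTV` (node U3 ∕ §N19 s1's two-run class-law comparison, TV currency), (V) `h0`, the shell split's MGF-part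
form and the class-measure sandwich `hS` are HYPOTHESIS SHAPES produced by nobody — UNPRINTED two-run statements for d = 4; the only mathematics is dag-n19-w2's [folklore] optimal
tilt constant (p600469 ∕ p601482), cited by name; the live-selector pin and the laws (H-ζ) ∕ `0 ≤ ζ` are displayed, claimed for no tuple (K0⁷ OPEN); nothing of Bałaban's is
asserted; NE7 ∕ NE1′ NOT PRINTED as two-run statements and NOT PROVED; N14 ∕ N19 ∕ N21 NOT discharged; K3⁷ OPEN, NOT claimed; counts UNMOVED (typed 28∕28 · discharged 5∕27,
A 5∕28); no count claim.  One finite four-torus programme at fixed `ε = L^{−K}`, Bałaban AS PRINTED — the YM mass gap (Clay) is NOT proved by any of this: R4 closes only the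
conditional finite-𝕋⁴ rung `BalabanLadder.UV`; NOT ℝ⁴, NOT OS, NOT a mass gap, NOT Clay.  0 `def`, 0 `sorry`, standard axioms, no `instance`, no `notation`; no decl below
carries a cite tag (bookkeeping [folklore]).
-/

set_option autoImplicit false

noncomputable section

open MeasureTheory ProbabilityTheory Finset
open scoped ENNReal BigOperators Matrix.Norms.L2Operator

namespace YMDAG.N14.AtSpineReading13CoPH.Sharp

open Literature.MathematicalPhysics.QuantumFieldTheory.Balaban1983to89
open Literature.MathematicalPhysics.QuantumFieldTheory.Balaban1983to89.T4Continuum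
open Literature.MathematicalPhysics.QuantumFieldTheory.Balaban1983to89.Node00
open B14.Eq218Concrete
open Summit.QuantumFields.BalabanUV.T4Continuum.Spine
open Summit.QuantumFields.BalabanUV.T4Continuum.NE1p.DressedMGFForm (MGFForm TiltedMeanMatching)
open Summit.QuantumFields.YangMills.BalabanUVNodes.N19ShapeFaceN14AtRecordTVSharp (tiltedMeanMatching_of_tv_atKeys_half tiltedMeanMatching_of_tv_atKeys_sharp)
open Summit.QuantumFields.YangMills.BalabanUVNodes.N19VacuumMGFRoad (core_of_coreZero_mgfForm)
open Summit.QuantumFields.YangMills.BalabanUVNodes.N19CoreTVInvariant (tvSandwich_of_classSandwich)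
open YMDAG.UVSplit hiding SU
open YMDAG.N14.AtSpineReading13CoPH

variable {F : T4Family} {N : ℕ} [NeZero N] (θ : Stage13HParams F N) (hP : θ.Provisos₁₃CoPH F N) (K₀ : ℕ) (jcut : ℕ → ℕ) (sh : ShellSplit₁₃CoPH N K₀)

/-! ## §1 At the ₁₃ reading `crOfRecord₁₃At K₀ jcut sh`: the binder at the half ∕ sharp rate, and the explicit-rate core -/

section Reading13

/-- **N14's BINDER AT THE SPINE READING OF RECORD, HALF RATE** — p593287 §3's `tiltedMeanMatching_crOfRecord₁₃At_of_tv` with `η K = 2·e^{2l₀}·ρ K` in place of `4·e^{2l₀}·ρ K`: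
U3's read-out sentence `hTV` (TV currency, produced by nobody) on the class laws of record pushed to the unit lattice ⇒ `TiltedMeanMatching` at the reading's `l₀ ∕ T ∕ Bad` for the
record's observables and class measures of record — dag-n19-w2 g3's drop-in `tiltedMeanMatching_of_tv_atKeys_half` BY NAME (finiteness from p593287 §2). [folklore] -/
theorem tiltedMeanMatching_crOfRecord₁₃At_of_tv_half (hζm : ZetaMeasurable F N θ.ζ) (g₀ : ℕ → ℝ) (os : List (ULoop F)) {ρ : ℕ → ℝ}
    (hTV : letI : DecidableEq (Σ K, SiteSeqKey F (K₀ + K)) := Classical.decEq _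
      ∀ (K : ℕ) (t : ℝ), |t| ≤ 1 → ∀ x ∈ classSet₁₃ θ K₀ g₀ K \ badClass₁₃ θ K₀ g₀ jcut K t, ∀ S : Set (GaugeField (F.P 0) 0 (Node00.SU N)), MeasurableSet S →
        |((classMeasB₁₃ θ K₀ g₀ K x).map
              ((T4RunLadder.unitFactorisation (datumOfRecord₁₃CoPH F N θ hP) (isPrintedAveraged_datumOfRecord₁₃CoPH F N θ hP).avgMeasurable g₀).A (K₀ + K + 1))).real S /
            ((classMeasB₁₃ θ K₀ g₀ K x).map
              ((T4RunLadder.unitFactorisation (datumOfRecord₁₃CoPH F N θ hP) (isPrintedAveraged_datumOfRecord₁₃CoPH F N θ hP).avgMeasurable g₀).A (K₀ + K + 1))).real Set.univ -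
          ((classMeasA₁₃ θ K₀ g₀ K x).map
              ((T4RunLadder.unitFactorisation (datumOfRecord₁₃CoPH F N θ hP) (isPrintedAveraged_datumOfRecord₁₃CoPH F N θ hP).avgMeasurable g₀).A (K₀ + K))).real S /
            ((classMeasA₁₃ θ K₀ g₀ K x).map
              ((T4RunLadder.unitFactorisation (datumOfRecord₁₃CoPH F N θ hP) (isPrintedAveraged_datumOfRecord₁₃CoPH F N θ hP).avgMeasurable g₀).A (K₀ + K))).real Set.univ| ≤
          ρ K) :
    letI := (crOfRecord₁₃At K₀ jcut sh F θ hP g₀ os).dec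
    TiltedMeanMatching (crOfRecord₁₃At K₀ jcut sh F θ hP g₀ os).l₀ (crOfRecord₁₃At K₀ jcut sh F θ hP g₀ os).T (crOfRecord₁₃At K₀ jcut sh F θ hP g₀ os).Bad
      (fun K (U : GaugeField (F.P (K₀ + K)) 0 (Node00.SU N)) => T4GenFunBounds.prodObs ((datumOfRecord₁₃CoPH F N θ hP).scheme g₀) (K₀ + K) os U) (classMeasA₁₃ θ K₀ g₀)
      (fun K (U : GaugeField (F.P (K₀ + K + 1)) 0 (Node00.SU N)) => T4GenFunBounds.prodObs ((datumOfRecord₁₃CoPH F N θ hP).scheme g₀) (K₀ + K + 1) os U) (classMeasB₁₃ θ K₀ g₀)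
      fun K => 2 * Real.exp (2 * (crOfRecord₁₃At K₀ jcut sh F θ hP g₀ os).l₀) * ρ K := by
  letI : DecidableEq (Σ K, SiteSeqKey F (K₀ + K)) := Classical.decEq _
  have h := tiltedMeanMatching_of_tv_atKeys_half (T := classSet₁₃ θ K₀ g₀) (Bad := badClass₁₃ θ K₀ g₀ jcut) (l₀ := 1) (ρ := ρ)
    (kA := fun K => K₀ + K) (kB := fun K => K₀ + K + 1) (νA := classMeasA₁₃ θ K₀ g₀) (νB := classMeasB₁₃ θ K₀ g₀)
    (T4RunLadder.unitFactorisation (datumOfRecord₁₃CoPH F N θ hP) (isPrintedAveraged_datumOfRecord₁₃CoPH F N θ hP).avgMeasurable g₀) os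
    (fun K x _ => isFiniteMeasure_classMeasA₁₃ θ K₀ hP hζm g₀ K x) (fun K x _ => isFiniteMeasure_classMeasB₁₃ θ K₀ hP hζm g₀ K x) hTV
  intro K t ht x hx u hu
  exact h K t ht x hx u hu

/-- **N14's BINDER AT THE SPINE READING OF RECORD, SHARP (ATTAINED) RATE** — the same with `η K = 2·e^{2l₀}ρ K ∕ (1 + (e^{2l₀} − 1)ρ K)` (dag-n19-w2 g3's `tiltedMeanMatching_of_tv_atKeys_sharp`
BY NAME: the odds reading of an `e^{±l₀}`-bounded tilt, attained by a two-point pair). [folklore] -/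
theorem tiltedMeanMatching_crOfRecord₁₃At_of_tv_sharp (hζm : ZetaMeasurable F N θ.ζ) (g₀ : ℕ → ℝ) (os : List (ULoop F)) {ρ : ℕ → ℝ}
    (hTV : letI : DecidableEq (Σ K, SiteSeqKey F (K₀ + K)) := Classical.decEq _
      ∀ (K : ℕ) (t : ℝ), |t| ≤ 1 → ∀ x ∈ classSet₁₃ θ K₀ g₀ K \ badClass₁₃ θ K₀ g₀ jcut K t, ∀ S : Set (GaugeField (F.P 0) 0 (Node00.SU N)), MeasurableSet S →
        |((classMeasB₁₃ θ K₀ g₀ K x).map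
              ((T4RunLadder.unitFactorisation (datumOfRecord₁₃CoPH F N θ hP) (isPrintedAveraged_datumOfRecord₁₃CoPH F N θ hP).avgMeasurable g₀).A (K₀ + K + 1))).real S /
            ((classMeasB₁₃ θ K₀ g₀ K x).map
              ((T4RunLadder.unitFactorisation (datumOfRecord₁₃CoPH F N θ hP) (isPrintedAveraged_datumOfRecord₁₃CoPH F N θ hP).avgMeasurable g₀).A (K₀ + K + 1))).real Set.univ -
          ((classMeasA₁₃ θ K₀ g₀ K x).map
              ((T4RunLadder.unitFactorisation (datumOfRecord₁₃CoPH F N θ hP) (isPrintedAveraged_datumOfRecord₁₃CoPH F N θ hP).avgMeasurable g₀).A (K₀ + K))).real S /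
            ((classMeasA₁₃ θ K₀ g₀ K x).map
              ((T4RunLadder.unitFactorisation (datumOfRecord₁₃CoPH F N θ hP) (isPrintedAveraged_datumOfRecord₁₃CoPH F N θ hP).avgMeasurable g₀).A (K₀ + K))).real Set.univ| ≤
          ρ K) :
    letI := (crOfRecord₁₃At K₀ jcut sh F θ hP g₀ os).dec
    TiltedMeanMatching (crOfRecord₁₃At K₀ jcut sh F θ hP g₀ os).l₀ (crOfRecord₁₃At K₀ jcut sh F θ hP g₀ os).T (crOfRecord₁₃At K₀ jcut sh F θ hP g₀ os).Bad
      (fun K (U : GaugeField (F.P (K₀ + K)) 0 (Node00.SU N)) => T4GenFunBounds.prodObs ((datumOfRecord₁₃CoPH F N θ hP).scheme g₀) (K₀ + K) os U) (classMeasA₁₃ θ K₀ g₀)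
      (fun K (U : GaugeField (F.P (K₀ + K + 1)) 0 (Node00.SU N)) => T4GenFunBounds.prodObs ((datumOfRecord₁₃CoPH F N θ hP).scheme g₀) (K₀ + K + 1) os U) (classMeasB₁₃ θ K₀ g₀)
      fun K => 2 * (Real.exp (2 * (crOfRecord₁₃At K₀ jcut sh F θ hP g₀ os).l₀) * ρ K /
        (1 + (Real.exp (2 * (crOfRecord₁₃At K₀ jcut sh F θ hP g₀ os).l₀) - 1) * ρ K)) := by
  letI : DecidableEq (Σ K, SiteSeqKey F (K₀ + K)) := Classical.decEq _
  have h := tiltedMeanMatching_of_tv_atKeys_sharp (T := classSet₁₃ θ K₀ g₀) (Bad := badClass₁₃ θ K₀ g₀ jcut) (l₀ := 1) (ρ := ρ)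
    (kA := fun K => K₀ + K) (kB := fun K => K₀ + K + 1) (νA := classMeasA₁₃ θ K₀ g₀) (νB := classMeasB₁₃ θ K₀ g₀)
    (T4RunLadder.unitFactorisation (datumOfRecord₁₃CoPH F N θ hP) (isPrintedAveraged_datumOfRecord₁₃CoPH F N θ hP).avgMeasurable g₀) os
    (fun K x _ => isFiniteMeasure_classMeasA₁₃ θ K₀ hP hζm g₀ K x) (fun K x _ => isFiniteMeasure_classMeasB₁₃ θ K₀ hP hζm g₀ K x) hTV
  intro K t ht x hx u hu
  exact h K t ht x hx u hu

/-- **★ N19′'s CORE AT THE READING's CARRIERS WITH THE RATE DISPLAYED, HALF (I)-SHARE** — p593287 §4's `coreEdge_reading₁₃_of_coreZero_of_tv` with the `δ` its ∃ hides made explicit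
and the (I)-share halved.  At one Stage-13 tuple with core provisos on the live-selector line (`hsel`; laws (H-ζ) `hζm`, `0 ≤ ζ` `hζ0`), DISPLAYED HYPOTHESES — each produced by nobody:
(V) `h0` = §N19 s1's bracket on the VACUUM shell-free class weights of record `weightA₁₃ − sh.1 ∕ weightB₁₃ − sh.2` at `t = 0`, width `δ₀`; (SH) the shell split `sh` in MGF-part form
(`νshA ≤ classMeasA₁₃`, `νshB ≤ classMeasB₁₃`, `MGFForm.sub`); (I) U3's read-out sentence, TV currency, for the SHELL-FREE class laws pushed to the unit lattice, width `ρ K`.  CONCLUSION: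
`NE7.Core 1 1 (classSet₁₃ …) (badClass₁₃ … jcut) (weightA₁₃ − sh.1) (weightB₁₃ − sh.2) (K ↦ δ₀ K + 2·e²·ρ K)` with the SAME constants `c_K` as the vacuum bracket — dag-n19-d's
`core_of_coreZero_mgfForm` (`δ = δ₀ + (l₀∕vol)·η`, here `l₀ = vol = 1`) over dag-n19-w2 g3's `tiltedMeanMatching_of_tv_atKeys_half` BY NAME; no summability letter is read. [folklore] -/
theorem core_reading₁₃_of_coreZero_of_tv_half (E : B12.RunParams → ℝ) (hsel : θ.ppSel = ppSelLiveOfRecord F N θ.ν θ.τ9 E (wOfRecord₉ F N θ.toStage9Params))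
    (hζm : ZetaMeasurable F N θ.ζ) (hζ0 : ∀ p g k s Pl Ql RS U V', 0 ≤ θ.ζ p g k s Pl Ql RS U V') (g₀ : ℕ → ℝ) (os : List (ULoop F)) {δ₀ ρ : ℕ → ℝ}
    (h0 : letI : DecidableEq (Σ K, SiteSeqKey F (K₀ + K)) := Classical.decEq _
      NE7.Core 1 1 (classSet₁₃ θ K₀ g₀) (badClass₁₃ θ K₀ g₀ jcut) (fun K _ x => weightA₁₃ θ hP K₀ g₀ os K 0 x - (sh F θ hP g₀ os).1 K 0 x)
        (fun K _ x => weightB₁₃ θ hP K₀ g₀ os K 0 x - (sh F θ hP g₀ os).2 K 0 x) δ₀)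
    {νshA : ∀ K, (Σ K, SiteSeqKey F (K₀ + K)) → Measure (GaugeField (F.P (K₀ + K)) 0 (Node00.SU N))}
    {νshB : ∀ K, (Σ K, SiteSeqKey F (K₀ + K)) → Measure (GaugeField (F.P (K₀ + K + 1)) 0 (Node00.SU N))}
    (hshA : MGFForm 1 (classSet₁₃ θ K₀ g₀)
      (fun K (U : GaugeField (F.P (K₀ + K)) 0 (Node00.SU N)) => T4GenFunBounds.prodObs ((datumOfRecord₁₃CoPH F N θ hP).scheme g₀) (K₀ + K) os U) νshA (sh F θ hP g₀ os).1)
    (hleA : ∀ K, ∀ x ∈ classSet₁₃ θ K₀ g₀ K, νshA K x ≤ classMeasA₁₃ θ K₀ g₀ K x)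
    (hshB : MGFForm 1 (classSet₁₃ θ K₀ g₀)
      (fun K (U : GaugeField (F.P (K₀ + K + 1)) 0 (Node00.SU N)) => T4GenFunBounds.prodObs ((datumOfRecord₁₃CoPH F N θ hP).scheme g₀) (K₀ + K + 1) os U) νshB (sh F θ hP g₀ os).2)
    (hleB : ∀ K, ∀ x ∈ classSet₁₃ θ K₀ g₀ K, νshB K x ≤ classMeasB₁₃ θ K₀ g₀ K x)
    (hTV : letI : DecidableEq (Σ K, SiteSeqKey F (K₀ + K)) := Classical.decEq _
      ∀ (K : ℕ) (t : ℝ), |t| ≤ 1 → ∀ x ∈ classSet₁₃ θ K₀ g₀ K \ badClass₁₃ θ K₀ g₀ jcut K t, ∀ S : Set (GaugeField (F.P 0) 0 (Node00.SU N)), MeasurableSet S →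
        |((classMeasB₁₃ θ K₀ g₀ K x - νshB K x).map
              ((T4RunLadder.unitFactorisation (datumOfRecord₁₃CoPH F N θ hP) (isPrintedAveraged_datumOfRecord₁₃CoPH F N θ hP).avgMeasurable g₀).A (K₀ + K + 1))).real S /
            ((classMeasB₁₃ θ K₀ g₀ K x - νshB K x).map
              ((T4RunLadder.unitFactorisation (datumOfRecord₁₃CoPH F N θ hP) (isPrintedAveraged_datumOfRecord₁₃CoPH F N θ hP).avgMeasurable g₀).A (K₀ + K + 1))).real Set.univ -
          ((classMeasA₁₃ θ K₀ g₀ K x - νshA K x).map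
              ((T4RunLadder.unitFactorisation (datumOfRecord₁₃CoPH F N θ hP) (isPrintedAveraged_datumOfRecord₁₃CoPH F N θ hP).avgMeasurable g₀).A (K₀ + K))).real S /
            ((classMeasA₁₃ θ K₀ g₀ K x - νshA K x).map
              ((T4RunLadder.unitFactorisation (datumOfRecord₁₃CoPH F N θ hP) (isPrintedAveraged_datumOfRecord₁₃CoPH F N θ hP).avgMeasurable g₀).A (K₀ + K))).real Set.univ| ≤
          ρ K) :
    letI : DecidableEq (Σ K, SiteSeqKey F (K₀ + K)) := Classical.decEq _
    NE7.Core 1 1 (classSet₁₃ θ K₀ g₀) (badClass₁₃ θ K₀ g₀ jcut) (fun K t x => weightA₁₃ θ hP K₀ g₀ os K t x - (sh F θ hP g₀ os).1 K t x)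
      (fun K t x => weightB₁₃ θ hP K₀ g₀ os K t x - (sh F θ hP g₀ os).2 K t x) fun K => δ₀ K + 2 * Real.exp 2 * ρ K := by
  letI : DecidableEq (Σ K, SiteSeqKey F (K₀ + K)) := Classical.decEq _
  have hA := (mgfForm_weightA₁₃ θ K₀ hP E hsel hζm hζ0 g₀ os).sub hshA hleA
  have hB := (mgfForm_weightB₁₃ θ K₀ hP E hsel hζm hζ0 g₀ os).sub hshB hleB
  have h := tiltedMeanMatching_of_tv_atKeys_half (T := classSet₁₃ θ K₀ g₀) (Bad := badClass₁₃ θ K₀ g₀ jcut) (l₀ := 1) (ρ := ρ)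
    (kA := fun K => K₀ + K) (kB := fun K => K₀ + K + 1) (νA := fun K x => classMeasA₁₃ θ K₀ g₀ K x - νshA K x) (νB := fun K x => classMeasB₁₃ θ K₀ g₀ K x - νshB K x)
    (T4RunLadder.unitFactorisation (datumOfRecord₁₃CoPH F N θ hP) (isPrintedAveraged_datumOfRecord₁₃CoPH F N θ hP).avgMeasurable g₀) os hA.finite hB.finite hTV
  have hη : TiltedMeanMatching 1 (classSet₁₃ θ K₀ g₀) (badClass₁₃ θ K₀ g₀ jcut)
      (fun K (U : GaugeField (F.P (K₀ + K)) 0 (Node00.SU N)) => T4GenFunBounds.prodObs ((datumOfRecord₁₃CoPH F N θ hP).scheme g₀) (K₀ + K) os U)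
      (fun K x => classMeasA₁₃ θ K₀ g₀ K x - νshA K x)
      (fun K (U : GaugeField (F.P (K₀ + K + 1)) 0 (Node00.SU N)) => T4GenFunBounds.prodObs ((datumOfRecord₁₃CoPH F N θ hP).scheme g₀) (K₀ + K + 1) os U)
      (fun K x => classMeasB₁₃ θ K₀ g₀ K x - νshB K x) fun K => 2 * Real.exp 2 * ρ K := by
    intro K t ht x hx u hu
    have hK := h K t ht x hx u hu
    simp only [mul_one] at hK
    exact hK
  have hc := core_of_coreZero_mgfForm one_pos hA hB h0 hη
  simp only [div_one, one_mul] at hc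
  exact hc

end Reading13

/-! ## §2 At the V reading `crOfRecord₁₃VAt K₀ jcut sh` (volume letter `F.side ^ 4`): the binder at the half ∕ sharp rate, and the explicit-rate core -/

section ReadingV

/-- **N14's BINDER AT THE V READING OF RECORD, HALF RATE** — p596111 §1's `tiltedMeanMatching_crOfRecord₁₃VAt_of_tv` with `η K = 2·e^{2l₀}·ρ K` (the binder does not read `vol`;
the V reading's `l₀ ∕ T ∕ Bad ∕ dec` are the ₁₃ reading's). [folklore] -/
theorem tiltedMeanMatching_crOfRecord₁₃VAt_of_tv_half (hζm : ZetaMeasurable F N θ.ζ) (g₀ : ℕ → ℝ) (os : List (ULoop F)) {ρ : ℕ → ℝ}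
    (hTV : letI : DecidableEq (Σ K, SiteSeqKey F (K₀ + K)) := Classical.decEq _
      ∀ (K : ℕ) (t : ℝ), |t| ≤ 1 → ∀ x ∈ classSet₁₃ θ K₀ g₀ K \ badClass₁₃ θ K₀ g₀ jcut K t, ∀ S : Set (GaugeField (F.P 0) 0 (Node00.SU N)), MeasurableSet S →
        |((classMeasB₁₃ θ K₀ g₀ K x).map
              ((T4RunLadder.unitFactorisation (datumOfRecord₁₃CoPH F N θ hP) (isPrintedAveraged_datumOfRecord₁₃CoPH F N θ hP).avgMeasurable g₀).A (K₀ + K + 1))).real S /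
            ((classMeasB₁₃ θ K₀ g₀ K x).map
              ((T4RunLadder.unitFactorisation (datumOfRecord₁₃CoPH F N θ hP) (isPrintedAveraged_datumOfRecord₁₃CoPH F N θ hP).avgMeasurable g₀).A (K₀ + K + 1))).real Set.univ -
          ((classMeasA₁₃ θ K₀ g₀ K x).map
              ((T4RunLadder.unitFactorisation (datumOfRecord₁₃CoPH F N θ hP) (isPrintedAveraged_datumOfRecord₁₃CoPH F N θ hP).avgMeasurable g₀).A (K₀ + K))).real S /
            ((classMeasA₁₃ θ K₀ g₀ K x).map
              ((T4RunLadder.unitFactorisation (datumOfRecord₁₃CoPH F N θ hP) (isPrintedAveraged_datumOfRecord₁₃CoPH F N θ hP).avgMeasurable g₀).A (K₀ + K))).real Set.univ| ≤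
          ρ K) :
    letI := (crOfRecord₁₃VAt K₀ jcut sh F θ hP g₀ os).dec
    TiltedMeanMatching (crOfRecord₁₃VAt K₀ jcut sh F θ hP g₀ os).l₀ (crOfRecord₁₃VAt K₀ jcut sh F θ hP g₀ os).T (crOfRecord₁₃VAt K₀ jcut sh F θ hP g₀ os).Bad
      (fun K (U : GaugeField (F.P (K₀ + K)) 0 (Node00.SU N)) => T4GenFunBounds.prodObs ((datumOfRecord₁₃CoPH F N θ hP).scheme g₀) (K₀ + K) os U) (classMeasA₁₃ θ K₀ g₀)
      (fun K (U : GaugeField (F.P (K₀ + K + 1)) 0 (Node00.SU N)) => T4GenFunBounds.prodObs ((datumOfRecord₁₃CoPH F N θ hP).scheme g₀) (K₀ + K + 1) os U) (classMeasB₁₃ θ K₀ g₀)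
      fun K => 2 * Real.exp (2 * (crOfRecord₁₃VAt K₀ jcut sh F θ hP g₀ os).l₀) * ρ K := by
  have h := tiltedMeanMatching_crOfRecord₁₃At_of_tv_half θ hP K₀ jcut sh hζm g₀ os hTV
  intro K t ht x hx u hu
  exact h K t ht x hx u hu

/-- **N14's BINDER AT THE V READING OF RECORD, SHARP (ATTAINED) RATE** `η K = 2·e^{2l₀}ρ K ∕ (1 + (e^{2l₀} − 1)ρ K)`. [folklore] -/
theorem tiltedMeanMatching_crOfRecord₁₃VAt_of_tv_sharp (hζm : ZetaMeasurable F N θ.ζ) (g₀ : ℕ → ℝ) (os : List (ULoop F)) {ρ : ℕ → ℝ}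
    (hTV : letI : DecidableEq (Σ K, SiteSeqKey F (K₀ + K)) := Classical.decEq _
      ∀ (K : ℕ) (t : ℝ), |t| ≤ 1 → ∀ x ∈ classSet₁₃ θ K₀ g₀ K \ badClass₁₃ θ K₀ g₀ jcut K t, ∀ S : Set (GaugeField (F.P 0) 0 (Node00.SU N)), MeasurableSet S →
        |((classMeasB₁₃ θ K₀ g₀ K x).map
              ((T4RunLadder.unitFactorisation (datumOfRecord₁₃CoPH F N θ hP) (isPrintedAveraged_datumOfRecord₁₃CoPH F N θ hP).avgMeasurable g₀).A (K₀ + K + 1))).real S /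
            ((classMeasB₁₃ θ K₀ g₀ K x).map
              ((T4RunLadder.unitFactorisation (datumOfRecord₁₃CoPH F N θ hP) (isPrintedAveraged_datumOfRecord₁₃CoPH F N θ hP).avgMeasurable g₀).A (K₀ + K + 1))).real Set.univ -
          ((classMeasA₁₃ θ K₀ g₀ K x).map
              ((T4RunLadder.unitFactorisation (datumOfRecord₁₃CoPH F N θ hP) (isPrintedAveraged_datumOfRecord₁₃CoPH F N θ hP).avgMeasurable g₀).A (K₀ + K))).real S /
            ((classMeasA₁₃ θ K₀ g₀ K x).map
              ((T4RunLadder.unitFactorisation (datumOfRecord₁₃CoPH F N θ hP) (isPrintedAveraged_datumOfRecord₁₃CoPH F N θ hP).avgMeasurable g₀).A (K₀ + K))).real Set.univ| ≤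
          ρ K) :
    letI := (crOfRecord₁₃VAt K₀ jcut sh F θ hP g₀ os).dec
    TiltedMeanMatching (crOfRecord₁₃VAt K₀ jcut sh F θ hP g₀ os).l₀ (crOfRecord₁₃VAt K₀ jcut sh F θ hP g₀ os).T (crOfRecord₁₃VAt K₀ jcut sh F θ hP g₀ os).Bad
      (fun K (U : GaugeField (F.P (K₀ + K)) 0 (Node00.SU N)) => T4GenFunBounds.prodObs ((datumOfRecord₁₃CoPH F N θ hP).scheme g₀) (K₀ + K) os U) (classMeasA₁₃ θ K₀ g₀)
      (fun K (U : GaugeField (F.P (K₀ + K + 1)) 0 (Node00.SU N)) => T4GenFunBounds.prodObs ((datumOfRecord₁₃CoPH F N θ hP).scheme g₀) (K₀ + K + 1) os U) (classMeasB₁₃ θ K₀ g₀)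
      fun K => 2 * (Real.exp (2 * (crOfRecord₁₃VAt K₀ jcut sh F θ hP g₀ os).l₀) * ρ K /
        (1 + (Real.exp (2 * (crOfRecord₁₃VAt K₀ jcut sh F θ hP g₀ os).l₀) - 1) * ρ K)) := by
  have h := tiltedMeanMatching_crOfRecord₁₃At_of_tv_sharp θ hP K₀ jcut sh hζm g₀ os hTV
  intro K t ht x hx u hu
  exact h K t ht x hx u hu

/-- **★ N19′'s CORE AT THE V READING's CARRIERS WITH THE RATE DISPLAYED, HALF (I)-SHARE** — p596111 §2's `core_crOfRecord₁₃VAt_of_coreZero_of_tv` before the transfer to the canonical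
`δ`, with the rate explicit: (V) displayed at volume `F.side ^ 4` + (SH) in MGF-part form + (I) U3's TV sentence on the shell-free class laws ⇒ `NE7.Core 1 (F.side ^ 4) (classSet₁₃ …)
(badClass₁₃ … jcut) (weightA₁₃ − sh.1) (weightB₁₃ − sh.2) (K ↦ δ₀ K + (1 ∕ F.side⁴)·(2·e²·ρ K))`, same constants as the vacuum bracket (`core_of_coreZero_mgfForm` at `0 < F.side ^ 4`
over dag-n19-w2 g3's half-rate face BY NAME). [folklore] -/
theorem core_readingV₁₃_of_coreZero_of_tv_half (E : B12.RunParams → ℝ) (hsel : θ.ppSel = ppSelLiveOfRecord F N θ.ν θ.τ9 E (wOfRecord₉ F N θ.toStage9Params))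
    (hζm : ZetaMeasurable F N θ.ζ) (hζ0 : ∀ p g k s Pl Ql RS U V', 0 ≤ θ.ζ p g k s Pl Ql RS U V') (g₀ : ℕ → ℝ) (os : List (ULoop F)) {δ₀ ρ : ℕ → ℝ}
    (h0 : letI : DecidableEq (Σ K, SiteSeqKey F (K₀ + K)) := Classical.decEq _
      NE7.Core 1 ((F.side : ℝ) ^ 4) (classSet₁₃ θ K₀ g₀) (badClass₁₃ θ K₀ g₀ jcut) (fun K _ x => weightA₁₃ θ hP K₀ g₀ os K 0 x - (sh F θ hP g₀ os).1 K 0 x)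
        (fun K _ x => weightB₁₃ θ hP K₀ g₀ os K 0 x - (sh F θ hP g₀ os).2 K 0 x) δ₀)
    {νshA : ∀ K, (Σ K, SiteSeqKey F (K₀ + K)) → Measure (GaugeField (F.P (K₀ + K)) 0 (Node00.SU N))}
    {νshB : ∀ K, (Σ K, SiteSeqKey F (K₀ + K)) → Measure (GaugeField (F.P (K₀ + K + 1)) 0 (Node00.SU N))}
    (hshA : MGFForm 1 (classSet₁₃ θ K₀ g₀)
      (fun K (U : GaugeField (F.P (K₀ + K)) 0 (Node00.SU N)) => T4GenFunBounds.prodObs ((datumOfRecord₁₃CoPH F N θ hP).scheme g₀) (K₀ + K) os U) νshA (sh F θ hP g₀ os).1)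
    (hleA : ∀ K, ∀ x ∈ classSet₁₃ θ K₀ g₀ K, νshA K x ≤ classMeasA₁₃ θ K₀ g₀ K x)
    (hshB : MGFForm 1 (classSet₁₃ θ K₀ g₀)
      (fun K (U : GaugeField (F.P (K₀ + K + 1)) 0 (Node00.SU N)) => T4GenFunBounds.prodObs ((datumOfRecord₁₃CoPH F N θ hP).scheme g₀) (K₀ + K + 1) os U) νshB (sh F θ hP g₀ os).2)
    (hleB : ∀ K, ∀ x ∈ classSet₁₃ θ K₀ g₀ K, νshB K x ≤ classMeasB₁₃ θ K₀ g₀ K x)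
    (hTV : letI : DecidableEq (Σ K, SiteSeqKey F (K₀ + K)) := Classical.decEq _
      ∀ (K : ℕ) (t : ℝ), |t| ≤ 1 → ∀ x ∈ classSet₁₃ θ K₀ g₀ K \ badClass₁₃ θ K₀ g₀ jcut K t, ∀ S : Set (GaugeField (F.P 0) 0 (Node00.SU N)), MeasurableSet S →
        |((classMeasB₁₃ θ K₀ g₀ K x - νshB K x).map
              ((T4RunLadder.unitFactorisation (datumOfRecord₁₃CoPH F N θ hP) (isPrintedAveraged_datumOfRecord₁₃CoPH F N θ hP).avgMeasurable g₀).A (K₀ + K + 1))).real S /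
            ((classMeasB₁₃ θ K₀ g₀ K x - νshB K x).map
              ((T4RunLadder.unitFactorisation (datumOfRecord₁₃CoPH F N θ hP) (isPrintedAveraged_datumOfRecord₁₃CoPH F N θ hP).avgMeasurable g₀).A (K₀ + K + 1))).real Set.univ -
          ((classMeasA₁₃ θ K₀ g₀ K x - νshA K x).map
              ((T4RunLadder.unitFactorisation (datumOfRecord₁₃CoPH F N θ hP) (isPrintedAveraged_datumOfRecord₁₃CoPH F N θ hP).avgMeasurable g₀).A (K₀ + K))).real S /
            ((classMeasA₁₃ θ K₀ g₀ K x - νshA K x).map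
              ((T4RunLadder.unitFactorisation (datumOfRecord₁₃CoPH F N θ hP) (isPrintedAveraged_datumOfRecord₁₃CoPH F N θ hP).avgMeasurable g₀).A (K₀ + K))).real Set.univ| ≤
          ρ K) :
    letI : DecidableEq (Σ K, SiteSeqKey F (K₀ + K)) := Classical.decEq _
    NE7.Core 1 ((F.side : ℝ) ^ 4) (classSet₁₃ θ K₀ g₀) (badClass₁₃ θ K₀ g₀ jcut) (fun K t x => weightA₁₃ θ hP K₀ g₀ os K t x - (sh F θ hP g₀ os).1 K t x)
      (fun K t x => weightB₁₃ θ hP K₀ g₀ os K t x - (sh F θ hP g₀ os).2 K t x) fun K => δ₀ K + 1 / (F.side : ℝ) ^ 4 * (2 * Real.exp 2 * ρ K) := by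
  letI : DecidableEq (Σ K, SiteSeqKey F (K₀ + K)) := Classical.decEq _
  have hA := (mgfForm_weightA₁₃ θ K₀ hP E hsel hζm hζ0 g₀ os).sub hshA hleA
  have hB := (mgfForm_weightB₁₃ θ K₀ hP E hsel hζm hζ0 g₀ os).sub hshB hleB
  have h := tiltedMeanMatching_of_tv_atKeys_half (T := classSet₁₃ θ K₀ g₀) (Bad := badClass₁₃ θ K₀ g₀ jcut) (l₀ := 1) (ρ := ρ)
    (kA := fun K => K₀ + K) (kB := fun K => K₀ + K + 1) (νA := fun K x => classMeasA₁₃ θ K₀ g₀ K x - νshA K x) (νB := fun K x => classMeasB₁₃ θ K₀ g₀ K x - νshB K x)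
    (T4RunLadder.unitFactorisation (datumOfRecord₁₃CoPH F N θ hP) (isPrintedAveraged_datumOfRecord₁₃CoPH F N θ hP).avgMeasurable g₀) os hA.finite hB.finite hTV
  have hη : TiltedMeanMatching 1 (classSet₁₃ θ K₀ g₀) (badClass₁₃ θ K₀ g₀ jcut)
      (fun K (U : GaugeField (F.P (K₀ + K)) 0 (Node00.SU N)) => T4GenFunBounds.prodObs ((datumOfRecord₁₃CoPH F N θ hP).scheme g₀) (K₀ + K) os U)
      (fun K x => classMeasA₁₃ θ K₀ g₀ K x - νshA K x)
      (fun K (U : GaugeField (F.P (K₀ + K + 1)) 0 (Node00.SU N)) => T4GenFunBounds.prodObs ((datumOfRecord₁₃CoPH F N θ hP).scheme g₀) (K₀ + K + 1) os U)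
      (fun K x => classMeasB₁₃ θ K₀ g₀ K x - νshB K x) fun K => 2 * Real.exp 2 * ρ K := by
    intro K t ht x hx u hu
    have hK := h K t ht x hx u hu
    simp only [mul_one] at hK
    exact hK
  exact core_of_coreZero_mgfForm (pow_pos F.side_pos 4) hA hB h0 hη

end ReadingV

/-! ## §2′ … with (SH) DISCHARGED at n21-d's shell split of record `shellSplitOfRecord₁₃At N K₀ ρA ρB` (explicit rate) -/

section ShellOfRecord

open Summit.QuantumFields.YangMills.Theorems.N21ShellSplitOfRecord13CoPH (shellA₁₃ shellB₁₃ shellSplitOfRecord₁₃At WidthLetter₁₃CoPH)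
open YMDAG.N14.AtSpineReading13CoPH.Shell

/-- **★ N19′'s CORE AT THE V READING `crOfRecord₁₃VAt K₀ jcut (shellSplitOfRecord₁₃At N K₀ ρA ρB)`'s CARRIERS, RATE DISPLAYED, FROM (V) + U3's (I) ONLY** — p596111 §3's
`core_crOfRecord₁₃VAt_shellSplitOfRecord_of_coreZero_of_tv` before the canonical-`δ` transfer, with the (I)-share halved and explicit: for n21-d's shell split of record with ANY width
letters `ρA ρB`, (V) on the VACUUM shell-free class weights of record at volume `F.side ^ 4` + (I) U3's TV sentence for the shell-free class laws of record `classMeasA₁₃ − shellMeasA₁₃ ∕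
classMeasB₁₃ − shellMeasB₁₃` pushed to the unit lattice ⇒ `NE7.Core 1 (F.side ^ 4) … (weightA₁₃ − shellA₁₃) (weightB₁₃ − shellB₁₃) (K ↦ δ₀ K + (1 ∕ F.side⁴)·(2·e²·ρ K))` ((SH) :=
the shell sibling p594686's `mgfForm_shellA₁₃ ∕ shellMeasA₁₃_le ∕ mgfForm_shellB₁₃ ∕ shellMeasB₁₃_le` BY NAME). [folklore] -/
theorem core_readingV₁₃_shellSplitOfRecord_of_coreZero_of_tv_half (ρA ρB : WidthLetter₁₃CoPH N)
    (E : B12.RunParams → ℝ) (hsel : θ.ppSel = ppSelLiveOfRecord F N θ.ν θ.τ9 E (wOfRecord₉ F N θ.toStage9Params))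
    (hζm : ZetaMeasurable F N θ.ζ) (hζ0 : ∀ p g k s Pl Ql RS U V', 0 ≤ θ.ζ p g k s Pl Ql RS U V') (g₀ : ℕ → ℝ) (os : List (ULoop F)) {δ₀ ρ : ℕ → ℝ}
    (h0 : letI : DecidableEq (Σ K, SiteSeqKey F (K₀ + K)) := Classical.decEq _
      NE7.Core 1 ((F.side : ℝ) ^ 4) (classSet₁₃ θ K₀ g₀) (badClass₁₃ θ K₀ g₀ jcut)
        (fun K _ x => weightA₁₃ θ hP K₀ g₀ os K 0 x - shellA₁₃ θ hP K₀ g₀ os (ρA F θ hP g₀ os) K 0 x)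
        (fun K _ x => weightB₁₃ θ hP K₀ g₀ os K 0 x - shellB₁₃ θ hP K₀ g₀ os (ρB F θ hP g₀ os) K 0 x) δ₀)
    (hTV : letI : DecidableEq (Σ K, SiteSeqKey F (K₀ + K)) := Classical.decEq _
      ∀ (K : ℕ) (t : ℝ), |t| ≤ 1 → ∀ x ∈ classSet₁₃ θ K₀ g₀ K \ badClass₁₃ θ K₀ g₀ jcut K t, ∀ S : Set (GaugeField (F.P 0) 0 (Node00.SU N)), MeasurableSet S →
        |((classMeasB₁₃ θ K₀ g₀ K x - shellMeasB₁₃ θ K₀ g₀ (ρB F θ hP g₀ os) K x).map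
              ((T4RunLadder.unitFactorisation (datumOfRecord₁₃CoPH F N θ hP) (isPrintedAveraged_datumOfRecord₁₃CoPH F N θ hP).avgMeasurable g₀).A (K₀ + K + 1))).real S /
            ((classMeasB₁₃ θ K₀ g₀ K x - shellMeasB₁₃ θ K₀ g₀ (ρB F θ hP g₀ os) K x).map
              ((T4RunLadder.unitFactorisation (datumOfRecord₁₃CoPH F N θ hP) (isPrintedAveraged_datumOfRecord₁₃CoPH F N θ hP).avgMeasurable g₀).A (K₀ + K + 1))).real Set.univ -
          ((classMeasA₁₃ θ K₀ g₀ K x - shellMeasA₁₃ θ K₀ g₀ (ρA F θ hP g₀ os) K x).map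
              ((T4RunLadder.unitFactorisation (datumOfRecord₁₃CoPH F N θ hP) (isPrintedAveraged_datumOfRecord₁₃CoPH F N θ hP).avgMeasurable g₀).A (K₀ + K))).real S /
            ((classMeasA₁₃ θ K₀ g₀ K x - shellMeasA₁₃ θ K₀ g₀ (ρA F θ hP g₀ os) K x).map
              ((T4RunLadder.unitFactorisation (datumOfRecord₁₃CoPH F N θ hP) (isPrintedAveraged_datumOfRecord₁₃CoPH F N θ hP).avgMeasurable g₀).A (K₀ + K))).real Set.univ| ≤
          ρ K) :
    letI : DecidableEq (Σ K, SiteSeqKey F (K₀ + K)) := Classical.decEq _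
    NE7.Core 1 ((F.side : ℝ) ^ 4) (classSet₁₃ θ K₀ g₀) (badClass₁₃ θ K₀ g₀ jcut)
      (fun K t x => weightA₁₃ θ hP K₀ g₀ os K t x - shellA₁₃ θ hP K₀ g₀ os (ρA F θ hP g₀ os) K t x)
      (fun K t x => weightB₁₃ θ hP K₀ g₀ os K t x - shellB₁₃ θ hP K₀ g₀ os (ρB F θ hP g₀ os) K t x) fun K => δ₀ K + 1 / (F.side : ℝ) ^ 4 * (2 * Real.exp 2 * ρ K) :=
  core_readingV₁₃_of_coreZero_of_tv_half θ hP K₀ jcut (shellSplitOfRecord₁₃At N K₀ ρA ρB) E hsel hζm hζ0 g₀ os h0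
    (mgfForm_shellA₁₃ θ K₀ hP E hsel hζm hζ0 g₀ os (ρA F θ hP g₀ os)) (fun K x _ => shellMeasA₁₃_le θ K₀ hζm g₀ (ρA F θ hP g₀ os) K x)
    (mgfForm_shellB₁₃ θ K₀ hP E hsel hζm hζ0 g₀ os (ρB F θ hP g₀ os)) (fun K x _ => shellMeasB₁₃_le θ K₀ hζm g₀ (ρB F θ hP g₀ os) K x) hTV

end ShellOfRecord

/-! ## §3 NE7-S_cl ⇒ N14's binder at the V reading, half ∕ sharp rate (p603135's twins) -/

section ClassSandwich

/-- **★ N14's (I)-BINDER AT THE V READING FROM NODE U3's ONE-CONSTANT CLASS-MEASURE SENTENCE, HALF RATE** — p603135 §1's `tiltedMeanMatching_crOfRecord₁₃VAt_of_classSandwich` with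
`η K = 2·e^{2 l₀}·(e^{2 r K} − 1)` (was `4·…`): ONE constant `c` sandwiching the FULL class laws of record pushed to the unit lattice on every good key, width `r K ≥ 0` ⇒ TV_cl of width
`e^{2 r K} − 1` (dag-n19-c `tvSandwich_of_classSandwich`, finite pushed-forward pieces) ⇒ §2's half-rate binder. [folklore] -/
theorem tiltedMeanMatching_crOfRecord₁₃VAt_of_classSandwich_half (hζm : ZetaMeasurable F N θ.ζ) (g₀ : ℕ → ℝ) (os : List (ULoop F)) {r : ℕ → ℝ} (hr : ∀ K, 0 ≤ r K)
    (hS : letI : DecidableEq (Σ K, SiteSeqKey F (K₀ + K)) := Classical.decEq _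
      ∀ K : ℕ, ∃ c : ℝ, ∀ t : ℝ, |t| ≤ 1 → ∀ x ∈ classSet₁₃ θ K₀ g₀ K \ badClass₁₃ θ K₀ g₀ jcut K t,
        ENNReal.ofReal (Real.exp (c - r K)) • (classMeasA₁₃ θ K₀ g₀ K x).map ((T4RunLadder.unitFactorisation (datumOfRecord₁₃CoPH F N θ hP) (isPrintedAveraged_datumOfRecord₁₃CoPH F N θ hP).avgMeasurable g₀).A (K₀ + K)) ≤ (classMeasB₁₃ θ K₀ g₀ K x).map ((T4RunLadder.unitFactorisation (datumOfRecord₁₃CoPH F N θ hP) (isPrintedAveraged_datumOfRecord₁₃CoPH F N θ hP).avgMeasurable g₀).A (K₀ + K + 1)) ∧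
        (classMeasB₁₃ θ K₀ g₀ K x).map ((T4RunLadder.unitFactorisation (datumOfRecord₁₃CoPH F N θ hP) (isPrintedAveraged_datumOfRecord₁₃CoPH F N θ hP).avgMeasurable g₀).A (K₀ + K + 1)) ≤ ENNReal.ofReal (Real.exp (c + r K)) • (classMeasA₁₃ θ K₀ g₀ K x).map ((T4RunLadder.unitFactorisation (datumOfRecord₁₃CoPH F N θ hP) (isPrintedAveraged_datumOfRecord₁₃CoPH F N θ hP).avgMeasurable g₀).A (K₀ + K))) :
    letI := (crOfRecord₁₃VAt K₀ jcut sh F θ hP g₀ os).dec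
    TiltedMeanMatching (crOfRecord₁₃VAt K₀ jcut sh F θ hP g₀ os).l₀ (crOfRecord₁₃VAt K₀ jcut sh F θ hP g₀ os).T (crOfRecord₁₃VAt K₀ jcut sh F θ hP g₀ os).Bad
      (fun K (U : GaugeField (F.P (K₀ + K)) 0 (Node00.SU N)) => T4GenFunBounds.prodObs ((datumOfRecord₁₃CoPH F N θ hP).scheme g₀) (K₀ + K) os U) (classMeasA₁₃ θ K₀ g₀)
      (fun K (U : GaugeField (F.P (K₀ + K + 1)) 0 (Node00.SU N)) => T4GenFunBounds.prodObs ((datumOfRecord₁₃CoPH F N θ hP).scheme g₀) (K₀ + K + 1) os U) (classMeasB₁₃ θ K₀ g₀)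
      fun K => 2 * Real.exp (2 * (crOfRecord₁₃VAt K₀ jcut sh F θ hP g₀ os).l₀) * (Real.exp (2 * r K) - 1) := by
  letI : DecidableEq (Σ K, SiteSeqKey F (K₀ + K)) := Classical.decEq _
  set Nf := (T4RunLadder.unitFactorisation (datumOfRecord₁₃CoPH F N θ hP) (isPrintedAveraged_datumOfRecord₁₃CoPH F N θ hP).avgMeasurable g₀) with hNf
  have hTV := tvSandwich_of_classSandwich (Ω := fun _ => GaugeField (F.P 0) 0 (Node00.SU N)) (T := classSet₁₃ θ K₀ g₀) (Bad := badClass₁₃ θ K₀ g₀ jcut) (l₀ := 1) (r₂ := r)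
    (μA := fun K x => Measure.map (α := GaugeField (F.P (K₀ + K)) 0 (Node00.SU N)) (Nf.A (K₀ + K)) (classMeasA₁₃ θ K₀ g₀ K x))
    (μB := fun K x => Measure.map (α := GaugeField (F.P (K₀ + K + 1)) 0 (Node00.SU N)) (Nf.A (K₀ + K + 1)) (classMeasB₁₃ θ K₀ g₀ K x))
    (fun K x _ => by haveI := isFiniteMeasure_classMeasA₁₃ θ K₀ hP hζm g₀ K x; infer_instance) hr hS
  exact tiltedMeanMatching_crOfRecord₁₃VAt_of_tv_half θ hP K₀ jcut sh hζm g₀ os hTV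

/-- **… SHARP (ATTAINED) RATE** `η K = 2·e^{2l₀}(e^{2 r K} − 1) ∕ (1 + (e^{2l₀} − 1)(e^{2 r K} − 1))`. [folklore] -/
theorem tiltedMeanMatching_crOfRecord₁₃VAt_of_classSandwich_sharp (hζm : ZetaMeasurable F N θ.ζ) (g₀ : ℕ → ℝ) (os : List (ULoop F)) {r : ℕ → ℝ} (hr : ∀ K, 0 ≤ r K)
    (hS : letI : DecidableEq (Σ K, SiteSeqKey F (K₀ + K)) := Classical.decEq _
      ∀ K : ℕ, ∃ c : ℝ, ∀ t : ℝ, |t| ≤ 1 → ∀ x ∈ classSet₁₃ θ K₀ g₀ K \ badClass₁₃ θ K₀ g₀ jcut K t,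
        ENNReal.ofReal (Real.exp (c - r K)) • (classMeasA₁₃ θ K₀ g₀ K x).map ((T4RunLadder.unitFactorisation (datumOfRecord₁₃CoPH F N θ hP) (isPrintedAveraged_datumOfRecord₁₃CoPH F N θ hP).avgMeasurable g₀).A (K₀ + K)) ≤ (classMeasB₁₃ θ K₀ g₀ K x).map ((T4RunLadder.unitFactorisation (datumOfRecord₁₃CoPH F N θ hP) (isPrintedAveraged_datumOfRecord₁₃CoPH F N θ hP).avgMeasurable g₀).A (K₀ + K + 1)) ∧
        (classMeasB₁₃ θ K₀ g₀ K x).map ((T4RunLadder.unitFactorisation (datumOfRecord₁₃CoPH F N θ hP) (isPrintedAveraged_datumOfRecord₁₃CoPH F N θ hP).avgMeasurable g₀).A (K₀ + K + 1)) ≤ ENNReal.ofReal (Real.exp (c + r K)) • (classMeasA₁₃ θ K₀ g₀ K x).map ((T4RunLadder.unitFactorisation (datumOfRecord₁₃CoPH F N θ hP) (isPrintedAveraged_datumOfRecord₁₃CoPH F N θ hP).avgMeasurable g₀).A (K₀ + K))) :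
    letI := (crOfRecord₁₃VAt K₀ jcut sh F θ hP g₀ os).dec
    TiltedMeanMatching (crOfRecord₁₃VAt K₀ jcut sh F θ hP g₀ os).l₀ (crOfRecord₁₃VAt K₀ jcut sh F θ hP g₀ os).T (crOfRecord₁₃VAt K₀ jcut sh F θ hP g₀ os).Bad
      (fun K (U : GaugeField (F.P (K₀ + K)) 0 (Node00.SU N)) => T4GenFunBounds.prodObs ((datumOfRecord₁₃CoPH F N θ hP).scheme g₀) (K₀ + K) os U) (classMeasA₁₃ θ K₀ g₀)
      (fun K (U : GaugeField (F.P (K₀ + K + 1)) 0 (Node00.SU N)) => T4GenFunBounds.prodObs ((datumOfRecord₁₃CoPH F N θ hP).scheme g₀) (K₀ + K + 1) os U) (classMeasB₁₃ θ K₀ g₀)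
      fun K => 2 * (Real.exp (2 * (crOfRecord₁₃VAt K₀ jcut sh F θ hP g₀ os).l₀) * (Real.exp (2 * r K) - 1) /
        (1 + (Real.exp (2 * (crOfRecord₁₃VAt K₀ jcut sh F θ hP g₀ os).l₀) - 1) * (Real.exp (2 * r K) - 1))) := by
  letI : DecidableEq (Σ K, SiteSeqKey F (K₀ + K)) := Classical.decEq _
  set Nf := (T4RunLadder.unitFactorisation (datumOfRecord₁₃CoPH F N θ hP) (isPrintedAveraged_datumOfRecord₁₃CoPH F N θ hP).avgMeasurable g₀) with hNf
  have hTV := tvSandwich_of_classSandwich (Ω := fun _ => GaugeField (F.P 0) 0 (Node00.SU N)) (T := classSet₁₃ θ K₀ g₀) (Bad := badClass₁₃ θ K₀ g₀ jcut) (l₀ := 1) (r₂ := r)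
    (μA := fun K x => Measure.map (α := GaugeField (F.P (K₀ + K)) 0 (Node00.SU N)) (Nf.A (K₀ + K)) (classMeasA₁₃ θ K₀ g₀ K x))
    (μB := fun K x => Measure.map (α := GaugeField (F.P (K₀ + K + 1)) 0 (Node00.SU N)) (Nf.A (K₀ + K + 1)) (classMeasB₁₃ θ K₀ g₀ K x))
    (fun K x _ => by haveI := isFiniteMeasure_classMeasA₁₃ θ K₀ hP hζm g₀ K x; infer_instance) hr hS
  exact tiltedMeanMatching_crOfRecord₁₃VAt_of_tv_sharp θ hP K₀ jcut sh hζm g₀ os hTV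

/-- **★ THE ZERO-CUT EDITION, HALF RATE** — p603135 §2's `tiltedMeanMatching_crOfRecord₁₃VAt_cutZero_of_classSandwich` with `η K = 2·e^{2l₀}·(e^{2 r K} − 1)`: the t-FREE ALL-KEYS
class-measure sentence on the FULL class laws of record (no class excused) ⇒ the binder at `crOfRecord₁₃VAt K₀ (fun _ ↦ 0) sh …` (any shell split). [folklore] -/
theorem tiltedMeanMatching_crOfRecord₁₃VAt_cutZero_of_classSandwich_half (hζm : ZetaMeasurable F N θ.ζ) (g₀ : ℕ → ℝ) (os : List (ULoop F)) {r : ℕ → ℝ}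
    (hr : ∀ K, 0 ≤ r K)
    (hS : letI : DecidableEq (Σ K, SiteSeqKey F (K₀ + K)) := Classical.decEq _
      ∀ K : ℕ, ∃ c : ℝ, ∀ x ∈ classSet₁₃ θ K₀ g₀ K,
        ENNReal.ofReal (Real.exp (c - r K)) • (classMeasA₁₃ θ K₀ g₀ K x).map ((T4RunLadder.unitFactorisation (datumOfRecord₁₃CoPH F N θ hP) (isPrintedAveraged_datumOfRecord₁₃CoPH F N θ hP).avgMeasurable g₀).A (K₀ + K)) ≤ (classMeasB₁₃ θ K₀ g₀ K x).map ((T4RunLadder.unitFactorisation (datumOfRecord₁₃CoPH F N θ hP) (isPrintedAveraged_datumOfRecord₁₃CoPH F N θ hP).avgMeasurable g₀).A (K₀ + K + 1)) ∧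
        (classMeasB₁₃ θ K₀ g₀ K x).map ((T4RunLadder.unitFactorisation (datumOfRecord₁₃CoPH F N θ hP) (isPrintedAveraged_datumOfRecord₁₃CoPH F N θ hP).avgMeasurable g₀).A (K₀ + K + 1)) ≤ ENNReal.ofReal (Real.exp (c + r K)) • (classMeasA₁₃ θ K₀ g₀ K x).map ((T4RunLadder.unitFactorisation (datumOfRecord₁₃CoPH F N θ hP) (isPrintedAveraged_datumOfRecord₁₃CoPH F N θ hP).avgMeasurable g₀).A (K₀ + K))) :
    letI := (crOfRecord₁₃VAt K₀ (fun _ => 0) sh F θ hP g₀ os).dec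
    TiltedMeanMatching (crOfRecord₁₃VAt K₀ (fun _ => 0) sh F θ hP g₀ os).l₀ (crOfRecord₁₃VAt K₀ (fun _ => 0) sh F θ hP g₀ os).T (crOfRecord₁₃VAt K₀ (fun _ => 0) sh F θ hP g₀ os).Bad
      (fun K (U : GaugeField (F.P (K₀ + K)) 0 (Node00.SU N)) => T4GenFunBounds.prodObs ((datumOfRecord₁₃CoPH F N θ hP).scheme g₀) (K₀ + K) os U) (classMeasA₁₃ θ K₀ g₀)
      (fun K (U : GaugeField (F.P (K₀ + K + 1)) 0 (Node00.SU N)) => T4GenFunBounds.prodObs ((datumOfRecord₁₃CoPH F N θ hP).scheme g₀) (K₀ + K + 1) os U) (classMeasB₁₃ θ K₀ g₀)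
      fun K => 2 * Real.exp (2 * (crOfRecord₁₃VAt K₀ (fun _ => 0) sh F θ hP g₀ os).l₀) * (Real.exp (2 * r K) - 1) := by
  letI : DecidableEq (Σ K, SiteSeqKey F (K₀ + K)) := Classical.decEq _
  refine tiltedMeanMatching_crOfRecord₁₃VAt_of_classSandwich_half θ hP K₀ (fun _ => 0) sh hζm g₀ os hr fun K => ?_
  obtain ⟨c, hc⟩ := hS K
  exact ⟨c, fun t _ x hx => hc x (Finset.mem_sdiff.1 hx).1⟩

end ClassSandwich

end YMDAG.N14.AtSpineReading13CoPH.Sharp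

end
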